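import Summits.BirchSwinnertonDyer.BirchSwinnertonDyer.Theorems.Rank2Observatory2DescKillSig3Core
import HarnessLib

/-!
# KERNEL-2DESC — the SIGNATURE kill certificate `sig3Check`: the disc walk, the certificate and its soundness (PART 2 of 2)

HONEST FRAMING: per-curve certified theorems and census instruments; no claim on BSD in rank ≥ 2.
PARTITION: none — rank ≥ 2 data (N3); no r ≤ 1 cell claimed.

SPLIT NOTE (cert-3 gen 27, mechanical; gate lint «Theorems files are ≤ 400 lines»): PART 2 of 2 of cert-1 gen 38's staged text
`generics/sig3/lean/Rank2Observatory2DescKillSig3.lean` (sha256 4ed9af8c3fb1177d…): original lines 374–721 with every declaration verbatim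
(one call site of the deleted duplicate helper `exists_pow_mul_not_dvd` inlined, EDIT-1 of PART 1's note) —
`walk`, `sig3Check`, `walk_sound`, `kill_of_walk`, `caseB`, `sig3Check_sound`, `killValidAt_of_sig3Check`. The mathematics, scope and design
are documented in the module docstring of PART 1 (`Rank2Observatory2DescKillSig3Core`), which holds the helpers, the core lemma, the index
lemma, the root relation and the certificate components up to `genOK`. A row's kill term is `killValidAt_of_sig3Check (by norm_num)
(by decide +kernel)` in place of `killValidAt_of_killCheck …` / `killValidAt_of_l2Check …`.
[cite: Cassels1991LecturesEllipticCurves, §15] [cite: CremonaAlgorithms1997, §3.6]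
-/

-- single-conjunct summit: `Summit.BirchSwinnertonDyer.BirchSwinnertonDyer.…` repeats the name by design
set_option linter.dupNamespace false

namespace Summit.BirchSwinnertonDyer.BirchSwinnertonDyer.Rank2Observatory.TwoDescKill

/-- **The disc walk** below the node `(c, j)` (disc `c + q^j ℤ_q` of `y`), fuelled, with the precision guard
`j + B < N`: an outside mismatch, or all inside digit children certified and the generic digit excluded.
[cite: CremonaAlgorithms1997, §3.6] -/
def walk (q : ℕ) (L : List (ℤ × ℕ × ℤ)) (B N : ℕ) : ℕ → ℤ → ℕ → Bool
  | 0, c, j => decide (j + B < N) && L.any (outMis q c j)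
  | f + 1, c, j =>
      decide (j + B < N) &&
        (L.any (outMis q c j) ||
          (((L.filter (isIn q c j)).all fun ρ =>
              walk q L B N f (c + digitOf q c j ρ * ((q ^ j : ℕ) : ℤ)) (j + 1)) &&
            genOK q c j (L.filter (isIn q c j))))

/-- **The signature kill certificate** at `q` for the class `z` (`θ`-coordinates `t₁, t₂`), field cubic
`X³ + aX² + bX + c` with approximate roots `ε₁, ε₂, ε₃` mod `q^N`: root tests, unit parts of the root
differences (`D = Σ v_q(εᵢ − εⱼ)`), not RATIONAL-like, and the disc walk from `(0, 0)` with guard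
`B = S + 2D`. [cite: CremonaAlgorithms1997, §3.6] -/
def sig3Check (q : ℕ) (a b c : ℤ) (z : ℤ × ℤ × ℤ) (t₁ t₂ : ℤ) (N : ℕ) (ε₁ ε₂ ε₃ : ℤ) : Bool :=
  let ρ₁ := rootData q N z t₁ t₂ ε₁
  let ρ₂ := rootData q N z t₁ t₂ ε₂
  let ρ₃ := rootData q N z t₁ t₂ ε₃
  let D := (splitPow q N (ε₁ - ε₂)).1 + (splitPow q N (ε₁ - ε₃)).1 + (splitPow q N (ε₂ - ε₃)).1
  let S := max ρ₁.2.1 (max ρ₂.2.1 ρ₃.2.1)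
  rootOK q N a b c ε₁ ρ₁ && rootOK q N a b c ε₂ ρ₂ && rootOK q N a b c ε₃ ρ₃ &&
    unitOK q (splitPow q N (ε₁ - ε₂)).2 && unitOK q (splitPow q N (ε₁ - ε₃)).2 &&
    unitOK q (splitPow q N (ε₂ - ε₃)).2 &&
    notRat q ρ₁ ρ₂ ρ₃ && walk q [ρ₁, ρ₂, ρ₃] (S + 2 * D) N N 0 0

/-! ### Soundness of the walk -/

/-- Base-`q` digit of an integer. [folklore] -/
theorem digit_exists {q : ℕ} (hq : 0 < q) (t : ℤ) : ∃ d : ℕ, d < q ∧ (q : ℤ) ∣ t - d := by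
  have hq' : (0 : ℤ) < q := by exact_mod_cast hq
  refine ⟨(t % (q : ℤ)).toNat, ?_, t / q, ?_⟩
  · have := Int.emod_lt_of_pos t hq'; have := Int.emod_nonneg t hq'.ne'; omega
  · rw [Int.toNat_of_nonneg (Int.emod_nonneg t hq'.ne')]
    linear_combination (-1 : ℤ) * Int.emod_add_ediv_mul t (q : ℤ)

/-- The precision guard of a certified node. [folklore] -/
theorem walk_guard {q : ℕ} {L : List (ℤ × ℕ × ℤ)} {B N : ℕ} :
    ∀ {f : ℕ} {c : ℤ} {j : ℕ}, walk q L B N f c j = true → j + B < N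
  | 0, c, j, h => by
      simp only [walk, Bool.and_eq_true, decide_eq_true_eq] at h; exact h.1
  | f + 1, c, j, h => by
      simp only [walk, Bool.and_eq_true, decide_eq_true_eq] at h; exact h.1

/-- **Outside mismatch is sound**: for `y ≡ c (mod q^j)` and a root with `v_q(c − e) < j`, the relation
`q^N ∣ q^s·u·X² − q^K·(y − e)` (`K` even, `K ≤ B`, `j + B < N`) forces the signature of the root to be that of
`c − e`. [cite: CremonaAlgorithms1997, §3.6] -/
theorem outMis_sound {q : ℕ} (hq : q.Prime) {c : ℤ} {j : ℕ} {ρ : ℤ × ℕ × ℤ} (hρ : ¬ (q : ℤ) ∣ ρ.2.2)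
    (h : outMis q c j ρ = true) {B N K : ℕ} (hK : K ≤ B) (hK2 : K % 2 = 0) (hj : j + B < N)
    {y : ℤ} (hy : (q : ℤ) ^ j ∣ y - c)
    (hX : ∃ X : ℤ, (q : ℤ) ^ N ∣ (q : ℤ) ^ ρ.2.1 * ρ.2.2 * X ^ 2 - (q : ℤ) ^ K * (y - ρ.1)) : False := by
  obtain ⟨X, hX⟩ := hX
  have cast_qj : ((q ^ j : ℕ) : ℤ) = (q : ℤ) ^ j := Nat.cast_pow q j
  simp only [outMis, Bool.and_eq_true, Bool.or_eq_true, Bool.not_eq_true', decide_eq_false_iff_not,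
    cast_qj] at h
  obtain ⟨⟨hδ, hw⟩, hmis⟩ := h
  have hsp : c - ρ.1 = (q : ℤ) ^ (splitPow q j (c - ρ.1)).1 * (splitPow q j (c - ρ.1)).2 :=
    splitPow_spec q j (c - ρ.1)
  set dv := (splitPow q j (c - ρ.1)).1 with hdv
  set w := (splitPow q j (c - ρ.1)).2 with hwdef
  have hw' : ¬ (q : ℤ) ∣ w := fun h => hw (Int.emod_eq_zero_of_dvd h)
  have hδ' : ¬ (q : ℤ) ^ j ∣ c - ρ.1 := fun h => hδ (Int.emod_eq_zero_of_dvd h)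
  have hdvj : dv < j := by
    by_contra hle
    push Not at hle
    exact hδ' (hsp ▸ dvd_mul_of_dvd_left (pow_dvd_pow _ hle) w)
  obtain ⟨t, ht⟩ := hy
  obtain ⟨i, hi⟩ : ∃ i, j = dv + (i + 1) := ⟨j - dv - 1, by omega⟩
  have hye : y - ρ.1 = (q : ℤ) ^ dv * (w + (q : ℤ) ^ (i + 1) * t) := by
    have e : y - ρ.1 = (y - c) + (c - ρ.1) := by ring
    rw [e, ht, hsp, hi, pow_add]; ring
  have hw'' : ¬ (q : ℤ) ∣ w + (q : ℤ) ^ (i + 1) * t := by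
    intro h
    apply hw'
    have h2 : (q : ℤ) ∣ (q : ℤ) ^ (i + 1) * t := dvd_mul_of_dvd_left (dvd_pow_self _ (Nat.succ_ne_zero i)) t
    simpa using dvd_sub h h2
  have hrel : (q : ℤ) ^ N ∣ (q : ℤ) ^ ρ.2.1 * ρ.2.2 * X ^ 2 - (q : ℤ) ^ (K + dv) * (w + (q : ℤ) ^ (i + 1) * t) := by
    have e : (q : ℤ) ^ K * (y - ρ.1) = (q : ℤ) ^ (K + dv) * (w + (q : ℤ) ^ (i + 1) * t) := by
      rw [hye, pow_add]; ring
    rwa [e] at hX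
  have hc := core hq hρ hw'' (K + dv) ρ.2.1 N X (by omega) hrel
  have hbit : eulerBit q (w + (q : ℤ) ^ (i + 1) * t) = eulerBit q w :=
    eulerBit_congr ⟨(q : ℤ) ^ i * t, by ring⟩
  rcases hmis with hpar | hbit'
  · apply hpar
    have := hc.1
    omega
  · exact hbit' (hc.2.trans hbit)

/-- **Walk soundness**: a certified node `(c, j)` admits no `y ≡ c (mod q^j)` with
`q^N ∣ q^{sᵢ}·uᵢ·Xᵢ² − q^K·(y − eᵢ)` solvable for every root (`K` even, `K ≤ B`).
[cite: CremonaAlgorithms1997, §3.6] -/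
theorem walk_sound {q : ℕ} (hq : q.Prime) {L : List (ℤ × ℕ × ℤ)} (hL : ∀ ρ ∈ L, ¬ (q : ℤ) ∣ ρ.2.2)
    {B N K : ℕ} (hK : K ≤ B) (hK2 : K % 2 = 0) :
    ∀ (f : ℕ) (c : ℤ) (j : ℕ), walk q L B N f c j = true → ∀ y : ℤ, (q : ℤ) ^ j ∣ y - c →
      (∀ ρ ∈ L, ∃ X : ℤ, (q : ℤ) ^ N ∣ (q : ℤ) ^ ρ.2.1 * ρ.2.2 * X ^ 2 - (q : ℤ) ^ K * (y - ρ.1)) → False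
  | 0, c, j, h, y, hy, hX => by
      simp only [walk, Bool.and_eq_true, decide_eq_true_eq, List.any_eq_true] at h
      obtain ⟨hj, ρ, hρ, hm⟩ := h
      exact outMis_sound hq (hL ρ hρ) hm hK hK2 hj hy (hX ρ hρ)
  | f + 1, c, j, h, y, hy, hX => by
      simp only [walk, Bool.and_eq_true, Bool.or_eq_true, decide_eq_true_eq, List.any_eq_true,
        List.all_eq_true] at h
      obtain ⟨hj, h⟩ := h
      rcases h with ⟨ρ, hρ, hm⟩ | ⟨hrec, hgen⟩
      · exact outMis_sound hq (hL ρ hρ) hm hK hK2 hj hy (hX ρ hρ)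
      · have hq0 : 0 < q := hq.pos
        have hqZ : (0 : ℤ) < q := by exact_mod_cast hq0
        have cast_qj : ((q ^ j : ℕ) : ℤ) = (q : ℤ) ^ j := Nat.cast_pow q j
        obtain ⟨t, ht⟩ := hy
        obtain ⟨d, hd, hdt⟩ := digit_exists hq0 t
        -- inside roots: `e − c = q^j · tρ`, digit `= tρ mod q`
        have insd : ∀ ρ ∈ L.filter (isIn q c j), ρ ∈ L ∧
            ∃ tr : ℤ, ρ.1 - c = (q : ℤ) ^ j * tr ∧ digitOf q c j ρ = tr % (q : ℤ) := by
          intro ρ hρ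
          rw [List.mem_filter] at hρ
          obtain ⟨hρL, hin⟩ := hρ
          simp only [isIn, decide_eq_true_eq, cast_qj] at hin
          obtain ⟨tr, htr⟩ := Int.dvd_of_emod_eq_zero hin
          refine ⟨hρL, tr, htr, ?_⟩
          simp only [digitOf, cast_qj, htr]
          rw [Int.mul_ediv_cancel_left _ (pow_ne_zero _ hqZ.ne')]
        by_cases hcase : ∃ ρ ∈ L.filter (isIn q c j), digitOf q c j ρ = (d : ℤ)
        · -- the digit of `y` is the digit of an inside root: recurse
          obtain ⟨ρ, hρ, hdig⟩ := hcase
          have hw := hrec ρ hρ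
          rw [hdig, cast_qj] at hw
          refine walk_sound hq hL hK hK2 f _ (j + 1) hw y ?_ hX
          obtain ⟨k, hk⟩ := hdt
          exact ⟨k, by rw [pow_succ]; linear_combination ht + (q : ℤ) ^ j * hk⟩
        · -- generic digit
          push Not at hcase
          have key : ∀ ρ ∈ L.filter (isIn q c j),
              (ρ.2.1 + (K + j)) % 2 = 0 ∧ eulerBit q ρ.2.2 = eulerBit q ((d : ℤ) - digitOf q c j ρ) := by
            intro ρ hρ
            obtain ⟨hρL, tr, htr, hdig⟩ := insd ρ hρ
            have hne : digitOf q c j ρ ≠ d := hcase ρ hρ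
            obtain ⟨X, hXρ⟩ := hX ρ hρL
            have hye : y - ρ.1 = (q : ℤ) ^ j * (t - tr) := by linear_combination ht - htr
            have hmod : (q : ℤ) ∣ (t - tr) - ((d : ℤ) - digitOf q c j ρ) := by
              rw [hdig]
              obtain ⟨k, hk⟩ := hdt
              have e1 := Int.emod_add_ediv_mul tr (q : ℤ)
              exact ⟨k - tr / (q : ℤ), by linear_combination hk + e1⟩
            have h0 : 0 ≤ digitOf q c j ρ := by unfold digitOf; exact Int.emod_nonneg _ hqZ.ne'
            have h1 : digitOf q c j ρ < q := by unfold digitOf; exact Int.emod_lt_of_pos _ hqZ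
            have hd' : (d : ℤ) < q := by exact_mod_cast hd
            have hndvd : ¬ (q : ℤ) ∣ (d : ℤ) - digitOf q c j ρ := by
              intro hdv
              apply hne
              have := Int.eq_zero_of_dvd_of_natAbs_lt_natAbs hdv (by omega)
              omega
            have hunit : ¬ (q : ℤ) ∣ t - tr := by
              intro h
              apply hndvd
              simpa using dvd_sub h hmod
            have hrel : (q : ℤ) ^ N ∣ (q : ℤ) ^ ρ.2.1 * ρ.2.2 * X ^ 2 - (q : ℤ) ^ (K + j) * (t - tr) := by
              have e : (q : ℤ) ^ K * (y - ρ.1) = (q : ℤ) ^ (K + j) * (t - tr) := by rw [hye, pow_add]; ring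
              rwa [e] at hXρ
            have hc := core hq (hL ρ hρL) hunit (K + j) ρ.2.1 N X (by omega) hrel
            exact ⟨hc.1, hc.2.trans (eulerBit_congr hmod)⟩
          simp only [genOK, Bool.or_eq_true, List.any_eq_true, List.all_eq_true, Bool.and_eq_true,
            Bool.not_eq_true', decide_eq_false_iff_not, decide_eq_true_eq, List.mem_range] at hgen
          rcases hgen with (⟨ρ, hρ, hpar⟩ | ⟨ρ, hρ, ρ', hρ', hdd, hbits⟩) | hall
          · apply hpar
            have := (key ρ hρ).1
            omega
          · apply hbits
            rw [(key ρ hρ).2, (key ρ' hρ').2, hdd]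
          · obtain ⟨ρ, hρ, hdig⟩ := hall d hd
            exact hcase ρ hρ hdig

/-- **From the root relations to the walk**: if `q ∤ n'` and every root satisfies
`q^N ∣ q^s·u·R² − q^K·(y₀ − n'²·e)` (`K` even, `K ≤ B`), a certified walk from `(0, 0)` is contradictory
(take `y = y₀ / n'²` mod `q^N`). [cite: CremonaAlgorithms1997, §3.6] -/
theorem kill_of_walk {q : ℕ} (hq : q.Prime) {L : List (ℤ × ℕ × ℤ)} {B N f K : ℕ} (hK : K ≤ B)
    (hK2 : K % 2 = 0) (hwalk : walk q L B N f 0 0 = true) (hLu : ∀ ρ ∈ L, ¬ (q : ℤ) ∣ ρ.2.2)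
    {y₀ n' : ℤ} (hnd : ¬ (q : ℤ) ∣ n')
    (hrels : ∀ ρ ∈ L, ∃ R : ℤ,
      (q : ℤ) ^ N ∣ (q : ℤ) ^ ρ.2.1 * ρ.2.2 * R ^ 2 - (q : ℤ) ^ K * (y₀ - n' ^ 2 * ρ.1)) : False := by
  have hpZ : Prime (q : ℤ) := Nat.prime_iff_prime_int.mp hq
  have hcop : IsCoprime n' ((q : ℤ) ^ N) := ((Prime.coprime_iff_not_dvd hpZ).mpr hnd).symm.pow_right
  obtain ⟨m, k, hmk⟩ := hcop
  refine walk_sound hq hLu hK hK2 f 0 0 hwalk (y₀ * m ^ 2) (by simp) ?_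
  intro ρ hρ
  obtain ⟨R, t, ht⟩ := hrels ρ hρ
  exact ⟨R * m, m ^ 2 * t + (q : ℤ) ^ K * ρ.1 * k * (1 + m * n'), by
    linear_combination m ^ 2 * ht - (q : ℤ) ^ K * ρ.1 * (1 + m * n') * hmk⟩

/-- `notRat` says the three signatures are not all equal. [folklore] -/
theorem notRat_spec {q : ℕ} {ρ₁ ρ₂ ρ₃ : ℤ × ℕ × ℤ} (h : notRat q ρ₁ ρ₂ ρ₃ = true) :
    ¬ ∀ ρ ∈ [ρ₁, ρ₂, ρ₃], ∀ ρ' ∈ [ρ₁, ρ₂, ρ₃],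
      ρ.2.1 % 2 = ρ'.2.1 % 2 ∧ eulerBit q ρ.2.2 = eulerBit q ρ'.2.2 := by
  intro hall
  have h₁₂ := hall ρ₁ (by simp) ρ₂ (by simp)
  have h₂₃ := hall ρ₂ (by simp) ρ₃ (by simp)
  simp [notRat, h₁₂.1, h₁₂.2, h₂₃.1, h₂₃.2] at h

/-- **Case `q ∣ n`.** With a root `ρ₀` whose value `R₀` has `q^(D+1) ∤ R₀`: either `n²` carries more `q`
than `w₀ − n²e₀` — then every root has the signature of `(w₀ − n²e₀)`'s unit part (RATIONAL-like, excluded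
by `notRat`) — or `w₀ = q^{2τ}·w₀'`, `n = q^τ·n'` and the walk runs with the even offset `2τ ≤ S + 2D`.
[cite: CremonaAlgorithms1997, §3.6] -/
theorem caseB {q : ℕ} (hq : q.Prime) {L : List (ℤ × ℕ × ℤ)} {S D N f : ℕ} {w₀ n : ℤ}
    (hwalk : walk q L (S + 2 * D) N f 0 0 = true)
    (hL : ∀ ρ ∈ L, ¬ (q : ℤ) ∣ ρ.2.2 ∧ ρ.2.1 ≤ S ∧
      ∃ R : ℤ, (q : ℤ) ^ N ∣ (q : ℤ) ^ ρ.2.1 * ρ.2.2 * R ^ 2 - (w₀ - n ^ 2 * ρ.1))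
    (hrat : ¬ ∀ ρ ∈ L, ∀ ρ' ∈ L, ρ.2.1 % 2 = ρ'.2.1 % 2 ∧ eulerBit q ρ.2.2 = eulerBit q ρ'.2.2)
    {ρ₀ : ℤ × ℕ × ℤ} (hρ₀ : ρ₀ ∈ L) {R₀ : ℤ} (hR₀ : ¬ (q : ℤ) ^ (D + 1) ∣ R₀)
    (hrel₀ : (q : ℤ) ^ N ∣ (q : ℤ) ^ ρ₀.2.1 * ρ₀.2.2 * R₀ ^ 2 - (w₀ - n ^ 2 * ρ₀.1)) : False := by
  have hpZ : Prime (q : ℤ) := Nat.prime_iff_prime_int.mp hq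
  have hguard : 0 + (S + 2 * D) < N := walk_guard hwalk
  obtain ⟨hu₀, hs₀, -⟩ := hL ρ₀ hρ₀
  obtain ⟨μ, P', hP, hP', hμ⟩ := val_bound hq hu₀ hR₀ (by omega : ρ₀.2.1 + 2 * D < N) hrel₀
  have hμN : μ < N := by omega
  by_cases hcmp : (q : ℤ) ^ (μ + 1) ∣ n ^ 2
  · -- RATIONAL-like: all signatures equal
    apply hrat
    have sig : ∀ ρ ∈ L, ρ.2.1 % 2 = μ % 2 ∧ eulerBit q ρ.2.2 = eulerBit q P' := by
      intro ρ hρ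
      obtain ⟨hu, -, R, hrel⟩ := hL ρ hρ
      obtain ⟨tt, htt⟩ := hcmp
      have hw : w₀ - n ^ 2 * ρ.1 = (q : ℤ) ^ μ * (P' + (q : ℤ) * tt * (ρ₀.1 - ρ.1)) := by
        rw [pow_succ] at htt
        linear_combination hP + (ρ₀.1 - ρ.1) * htt
      have hunit : ¬ (q : ℤ) ∣ P' + (q : ℤ) * tt * (ρ₀.1 - ρ.1) := by
        intro h
        apply hP'
        have h2 : (q : ℤ) ∣ (q : ℤ) * tt * (ρ₀.1 - ρ.1) := ⟨tt * (ρ₀.1 - ρ.1), by ring⟩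
        simpa using dvd_sub h h2
      rw [hw] at hrel
      have hc := core hq hu hunit μ ρ.2.1 N R hμN hrel
      exact ⟨by have := hc.1; omega, hc.2.trans (eulerBit_congr ⟨tt * (ρ₀.1 - ρ.1), by ring⟩)⟩
    intro ρ hρ ρ' hρ'
    exact ⟨(sig ρ hρ).1.trans (sig ρ' hρ').1.symm, (sig ρ hρ).2.trans (sig ρ' hρ').2.symm⟩
  · -- the walk with offset `2τ`
    have hn0 : n ≠ 0 := by
      rintro rfl
      exact hcmp (by simp)
    obtain ⟨τ, n', hn', hnd⟩ : ∃ (k : ℕ) (x' : ℤ), n = (q : ℤ) ^ k * x' ∧ ¬ (q : ℤ) ∣ x' :=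
      ⟨_, (Int.finiteMultiplicity_iff.mpr ⟨by simpa using hq.one_lt.ne', hn0⟩).exists_eq_pow_mul_and_not_dvd⟩
    have h2τ : 2 * τ ≤ μ := by
      by_contra hlt
      push Not at hlt
      apply hcmp
      rw [hn', mul_pow, ← pow_mul]
      exact dvd_mul_of_dvd_left (pow_dvd_pow _ (by omega)) _
    obtain ⟨i, hi⟩ : ∃ i, μ = 2 * τ + i := ⟨μ - 2 * τ, by omega⟩
    have hw₀ : w₀ = (q : ℤ) ^ (2 * τ) * ((q : ℤ) ^ i * P' + n' ^ 2 * ρ₀.1) := by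
      have e := hP
      rw [hi, pow_add, hn', mul_pow, ← pow_mul] at e
      linear_combination e
    refine kill_of_walk hq (K := 2 * τ) (by omega) (by omega) hwalk (fun ρ hρ => (hL ρ hρ).1)
      (y₀ := (q : ℤ) ^ i * P' + n' ^ 2 * ρ₀.1) hnd ?_
    intro ρ hρ
    obtain ⟨-, -, R, hrel⟩ := hL ρ hρ
    refine ⟨R, ?_⟩
    have e : w₀ - n ^ 2 * ρ.1 = (q : ℤ) ^ (2 * τ) * ((q : ℤ) ^ i * P' + n' ^ 2 * ρ₀.1 - n' ^ 2 * ρ.1) := by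
      rw [hw₀, hn', mul_pow, ← pow_mul]; ring
    rwa [e] at hrel

/-! ### Soundness of the certificate -/

/-- **Soundness of the signature kill certificate**: if `sig3Check q … N ε₁ ε₂ ε₃ = true` for a prime `q`,
then `killQ` has no integer zero that is primitive at `q` — verbatim the conclusion of `killCheck_sound`.
[cite: Cassels1991LecturesEllipticCurves, §15] [cite: CremonaAlgorithms1997, §3.6] -/
theorem sig3Check_sound {q : ℕ} (hq : q.Prime) {a b c : ℤ} {z : ℤ × ℤ × ℤ} {t₁ t₂ : ℤ} {N : ℕ}
    {ε₁ ε₂ ε₃ : ℤ} (h : sig3Check q a b c z t₁ t₂ N ε₁ ε₂ ε₃ = true) (v : ℤ × ℤ × ℤ × ℤ)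
    (hprim : ¬ ((q : ℤ) ∣ v.1 ∧ (q : ℤ) ∣ v.2.1 ∧ (q : ℤ) ∣ v.2.2.1 ∧ (q : ℤ) ∣ v.2.2.2))
    (h0 : killQ a b c z t₁ t₂ v = 0) : False := by
  obtain ⟨r₀, r₁, r₂, n⟩ := v
  have hq0 : 0 < q := hq.pos
  simp only [sig3Check, Bool.and_eq_true] at h
  obtain ⟨⟨⟨⟨⟨⟨⟨hk₁, hk₂⟩, hk₃⟩, hu₁₂⟩, hu₁₃⟩, hu₂₃⟩, hrat⟩, hwalk⟩ := h
  simp only [rootOK, unitOK, Bool.and_eq_true, Bool.not_eq_true', decide_eq_true_eq,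
    decide_eq_false_iff_not] at hk₁ hk₂ hk₃ hu₁₂ hu₁₃ hu₂₃
  have hf₁₂ : ¬ (q : ℤ) ∣ (splitPow q N (ε₁ - ε₂)).2 := fun hd => hu₁₂ (Int.emod_eq_zero_of_dvd hd)
  have hf₁₃ : ¬ (q : ℤ) ∣ (splitPow q N (ε₁ - ε₃)).2 := fun hd => hu₁₃ (Int.emod_eq_zero_of_dvd hd)
  have hf₂₃ : ¬ (q : ℤ) ∣ (splitPow q N (ε₂ - ε₃)).2 := fun hd => hu₂₃ (Int.emod_eq_zero_of_dvd hd)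
  -- the three root relations
  have rel : ∀ ε : ℤ, (ε ^ 3 + a * ε ^ 2 + b * ε + c) % ((q ^ N : ℕ) : ℤ) = 0 →
      (q : ℤ) ^ N ∣ (q : ℤ) ^ (rootData q N z t₁ t₂ ε).2.1 * (rootData q N z t₁ t₂ ε).2.2 *
          (r₀ + r₁ * ε + r₂ * ε ^ 2) ^ 2 - ((zsq a b c z (r₀, r₁, r₂)).1 - n ^ 2 * (rootData q N z t₁ t₂ ε).1) := by
    intro ε hg
    have h1 := root_rel hg h0
    have h2 := splitPow_spec q N ((z.1 + z.2.1 * ε + z.2.2 * ε ^ 2) % ((q ^ N : ℕ) : ℤ))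
    simp only [rootData]
    rw [← h2]
    exact h1
  have rel₁ := rel ε₁ hk₁.1
  have rel₂ := rel ε₂ hk₂.1
  have rel₃ := rel ε₃ hk₃.1
  -- name the data
  generalize hw₀ : (zsq a b c z (r₀, r₁, r₂)).1 = w₀ at rel₁ rel₂ rel₃
  generalize hD : (splitPow q N (ε₁ - ε₂)).1 + (splitPow q N (ε₁ - ε₃)).1 + (splitPow q N (ε₂ - ε₃)).1 = D
    at hwalk
  generalize hρ₁ : rootData q N z t₁ t₂ ε₁ = ρ₁ at hk₁ rel₁ hrat hwalk
  generalize hρ₂ : rootData q N z t₁ t₂ ε₂ = ρ₂ at hk₂ rel₂ hrat hwalk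
  generalize hρ₃ : rootData q N z t₁ t₂ ε₃ = ρ₃ at hk₃ rel₃ hrat hwalk
  have hu₁ : ¬ (q : ℤ) ∣ ρ₁.2.2 := fun hd => hk₁.2 (Int.emod_eq_zero_of_dvd hd)
  have hu₂ : ¬ (q : ℤ) ∣ ρ₂.2.2 := fun hd => hk₂.2 (Int.emod_eq_zero_of_dvd hd)
  have hu₃ : ¬ (q : ℤ) ∣ ρ₃.2.2 := fun hd => hk₃.2 (Int.emod_eq_zero_of_dvd hd)
  have hLu : ∀ ρ ∈ [ρ₁, ρ₂, ρ₃], ¬ (q : ℤ) ∣ ρ.2.2 := by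
    intro ρ hρ
    simp only [List.mem_cons, List.not_mem_nil, or_false] at hρ
    rcases hρ with rfl | rfl | rfl
    · exact hu₁
    · exact hu₂
    · exact hu₃
  by_cases hn : (q : ℤ) ∣ n
  · -- `q ∣ n`: a root with `q^(D+1) ∤ R` by the index lemma, then `caseB`
    have hex : ∃ ρ ∈ [ρ₁, ρ₂, ρ₃], ∃ R : ℤ, ¬ (q : ℤ) ^ (D + 1) ∣ R ∧
        (q : ℤ) ^ N ∣ (q : ℤ) ^ ρ.2.1 * ρ.2.2 * R ^ 2 - (w₀ - n ^ 2 * ρ.1) := by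
      by_contra hall
      push Not at hall
      have d₁ : (q : ℤ) ^ (D + 1) ∣ r₀ + r₁ * ε₁ + r₂ * ε₁ ^ 2 := by
        by_contra hnd; exact hall ρ₁ (by simp) _ hnd rel₁
      have d₂ : (q : ℤ) ^ (D + 1) ∣ r₀ + r₁ * ε₂ + r₂ * ε₂ ^ 2 := by
        by_contra hnd; exact hall ρ₂ (by simp) _ hnd rel₂
      have d₃ : (q : ℤ) ^ (D + 1) ∣ r₀ + r₁ * ε₃ + r₂ * ε₃ ^ 2 := by
        by_contra hnd; exact hall ρ₃ (by simp) _ hnd rel₃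
      rw [← hD] at d₁ d₂ d₃
      have hidx := index_lemma hq (splitPow_spec q N (ε₁ - ε₂)) (splitPow_spec q N (ε₁ - ε₃))
        (splitPow_spec q N (ε₂ - ε₃)) hf₁₂ hf₁₃ hf₂₃ d₁ d₂ d₃
      exact hprim ⟨hidx.1, hidx.2.1, hidx.2.2, hn⟩
    obtain ⟨ρ, hρ, R, hR, hrel⟩ := hex
    refine caseB hq hwalk ?_ (notRat_spec hrat) hρ hR hrel
    intro ρ hρ
    simp only [List.mem_cons, List.not_mem_nil, or_false] at hρ
    rcases hρ with rfl | rfl | rfl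
    · exact ⟨hu₁, le_max_left _ _, _, rel₁⟩
    · exact ⟨hu₂, le_trans (le_max_left _ _) (le_max_right _ _), _, rel₂⟩
    · exact ⟨hu₃, le_trans (le_max_right _ _) (le_max_right _ _), _, rel₃⟩
  · -- `q ∤ n`: the walk at offset `0` with `y = w₀ / n²`
    refine kill_of_walk hq (K := 0) (Nat.zero_le _) (by rfl) hwalk hLu (y₀ := w₀) hn ?_
    intro ρ hρ
    simp only [List.mem_cons, List.not_mem_nil, or_false] at hρ
    rcases hρ with rfl | rfl | rfl
    · exact ⟨r₀ + r₁ * ε₁ + r₂ * ε₁ ^ 2, by rw [pow_zero, one_mul]; exact rel₁⟩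
    · exact ⟨r₀ + r₁ * ε₂ + r₂ * ε₂ ^ 2, by rw [pow_zero, one_mul]; exact rel₂⟩
    · exact ⟨r₀ + r₁ * ε₃ + r₂ * ε₃ ^ 2, by rw [pow_zero, one_mul]; exact rel₃⟩

/-- **Validity from the signature certificate**: `sig3Check` gives `KillValidAt`, at any prime — it drops into
`killListCheckV` / `admKillsV_sound` exactly like `killValidAt_of_l2Check`. [cite: CremonaAlgorithms1997, §3.6] -/
theorem killValidAt_of_sig3Check {q : ℕ} (hq : q.Prime) {a b c : ℤ} {z : ℤ × ℤ × ℤ} {t₁ t₂ : ℤ} {N : ℕ}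
    {ε₁ ε₂ ε₃ : ℤ} (h : sig3Check q a b c z t₁ t₂ N ε₁ ε₂ ε₃ = true) : KillValidAt q a b c z t₁ t₂ :=
  fun v hprim h0 => sig3Check_sound hq h v hprim h0

end Summit.BirchSwinnertonDyer.BirchSwinnertonDyer.Rank2Observatory.TwoDescKill
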